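import Summits.ResolutionOfSingularities.ResolutionOfSingularities.Theorems.ShallowCutAlg

/-!
# ShallowCutChart — the blow-up charts over a CLOSED cone-shallow point (slice 2/4 of the node «ShallowCut»)

`decomp-res-lens-2`, generation 32; engine letter (C) `PinchCut.FlatConeExit`.  Frame at a closed point `y` of the
curve (`IsConeShallowAt`): `(c₀, …, c_d, v)` a regular system of parameters of `A = 𝒪_{Y,y}` (`spanFinrank 𝔪 = d + 2`),
the curve prime `𝔭 = (c)`, `f = c₀ⁿ + Φ(c₁, …, c_d) + g ∈ 𝓘_y` with `Φ` a form of degree `n` whose coefficients lie in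
`𝔪`, `g ∈ 𝔭ⁿ⁺¹`, and `ConeShallow 𝔭 v Φ n`.  Blow up `𝔭`; at ANY point of the blow-up over `y` (a prime `𝔴` of a Rees
chart `B = chartRing c j` over `𝔪`, closed or not) the controlled transform `(𝓘𝒪 : tⁿ)` is NOT contained in `𝔪ⁿ`:

* §4 the quotient dictionary `q : B ↠ (A/𝔭)[T_i : i ≠ j]` (`chartQuotEquiv⁻¹ ∘ (mod c_j)`): values on `e_l`, on
  constants, on `c_j`; surjectivity; kernel inside every prime over `𝔪`;
* §5 `cone_chart` — `σ f = tⁿ · χ(H)`, `H = e₀ⁿ + Φ^φ(e₁, …, e_d) + c_j·r ∈ B` (homogeneity); `e₀ ∉ 𝔴` (in particular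
  the whole `c₀`-chart, `e₀ = 1`): `H` is a unit; `e₀ ∈ 𝔴` and `(𝓘𝒪 : tⁿ) ⊆ 𝔪ⁿ`: `s·H ∈ 𝔴ⁿ` for some `s ∉ 𝔴`, pushed
  along `q` into the REGULAR ring `(A/𝔭)[T]` where Zariski–Nagata (`mem_pow_of_mul_mem_pow_of_le`) moves it to a
  maximal ideal `𝔑' ∋ v̄, T₀`, contradicting `ConeShallow` transported along the rename equivalence (`coneShallow_rename`).

Sources: [Hironaka1964] Ch. III §1; [CossartJannsenSaito2020] Ch. 2, Ch. 8; [CossartPiltant2008] Prop. 4.2 (a);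
[Matsumura1987] Thms. 14.2, 16.2, 19.3; [StacksProject, Tag 0BIQ].
-/

open IsLocalRing
open Literature.AlgebraicGeometry.Resolution

namespace Summit.ResolutionOfSingularities.ResolutionOfSingularities.Theorems.ShallowCut

open Summit.ResolutionOfSingularities.ResolutionOfSingularities.Theorems.PinchCut

/-! ## §4  The quotient dictionary `q : B ↠ (A/𝔭)[T_i : i ≠ j]` of a Rees chart -/

section Quot

variable {A : Type} [CommRing A] {k : ℕ} (c : Fin k → A) (j : Fin k) (hq : IsQuasiRegular c)

/-- **The quotient dictionary** `q = chartQuotEquiv⁻¹ ∘ (mod φ(c_j)) : B → (A/(c))[T_i : i ≠ j]`. [folklore] -/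
noncomputable def chartQuot :
    chartRing c j →+* MvPolynomial {i : Fin k // i ≠ j} (A ⧸ Ideal.span (Set.range c)) :=
  (chartQuotEquiv c j hq).symm.toRingHom.comp (Ideal.Quotient.mk (Ideal.span {chartBase c j (c j)}))

/-- `q (e_l) = T_l` for `l ≠ j`. [folklore] -/
theorem chartQuot_gen {l : Fin k} (hl : l ≠ j) : chartQuot c j hq (chartGen c j l) = MvPolynomial.X ⟨l, hl⟩ := by
  change (chartQuotEquiv c j hq).symm (Ideal.Quotient.mk _ (chartGen c j l)) = _
  rw [RingEquiv.symm_apply_eq, chartQuotEquiv_apply, chartQuotMap_X]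

/-- `q (φ r) = C r̄`. [folklore] -/
theorem chartQuot_base (r : A) :
    chartQuot c j hq (chartBase c j r) = MvPolynomial.C (Ideal.Quotient.mk (Ideal.span (Set.range c)) r) := by
  change (chartQuotEquiv c j hq).symm (Ideal.Quotient.mk _ (chartBase c j r)) = _
  rw [RingEquiv.symm_apply_eq, chartQuotEquiv_apply, chartQuotMap_C]

/-- `q (φ c_j) = 0`. [folklore] -/
theorem chartQuot_centre : chartQuot c j hq (chartBase c j (c j)) = 0 := by
  change (chartQuotEquiv c j hq).symm (Ideal.Quotient.mk _ (chartBase c j (c j))) = 0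
  rw [Ideal.Quotient.eq_zero_iff_mem.mpr (Ideal.mem_span_singleton_self _), map_zero]

/-- `q` is surjective. [folklore] -/
theorem chartQuot_surjective : Function.Surjective (chartQuot c j hq) :=
  (chartQuotEquiv c j hq).symm.surjective.comp Ideal.Quotient.mk_surjective

/-- `ker q ⊆ 𝔴` for every ideal `𝔴 ∋ φ(c_j)`. [folklore] -/
theorem ker_chartQuot_le {𝔴 : Ideal (chartRing c j)} (h𝔴 : chartBase c j (c j) ∈ 𝔴) :
    RingHom.ker (chartQuot c j hq) ≤ 𝔴 := by
  intro b hb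
  rw [RingHom.mem_ker] at hb
  change (chartQuotEquiv c j hq).symm (Ideal.Quotient.mk _ b) = 0 at hb
  rw [map_eq_zero_iff _ (chartQuotEquiv c j hq).symm.injective, Ideal.Quotient.eq_zero_iff_mem] at hb
  obtain ⟨w, rfl⟩ := Ideal.mem_span_singleton'.mp hb
  exact 𝔴.mul_mem_left _ h𝔴

/-- The image `q(𝔴)` of a prime `𝔴 ∋ φ(c_j)` is prime, and `q s ∈ q(𝔴)` only for `s ∈ 𝔴`. [folklore] -/
theorem map_chartQuot_isPrime {𝔴 : Ideal (chartRing c j)} [𝔴.IsPrime] (h𝔴 : chartBase c j (c j) ∈ 𝔴) :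
    (𝔴.map (chartQuot c j hq)).IsPrime ∧
      ∀ s, chartQuot c j hq s ∈ 𝔴.map (chartQuot c j hq) → s ∈ 𝔴 := by
  refine ⟨Ideal.map_isPrime_of_surjective (chartQuot_surjective c j hq) (ker_chartQuot_le c j hq h𝔴),
    fun s hs => ?_⟩
  have h := Ideal.mem_comap.mpr hs
  rw [Ideal.comap_map_of_surjective _ (chartQuot_surjective c j hq)] at h
  have hle : 𝔴 ⊔ Ideal.comap (chartQuot c j hq) ⊥ ≤ 𝔴 :=
    sup_le le_rfl (by rw [← RingHom.ker_eq_comap_bot]; exact ker_chartQuot_le c j hq h𝔴)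
  exact hle h

end Quot

/-! ## §5  The chart law over a CLOSED cone-shallow point: `(𝓘𝒪 : tⁿ) ⊄ 𝔪ⁿ` at every prime over `𝔪_A` -/

section Chart

variable {A : Type} [CommRing A] {n d : ℕ}

/-- **Factorisation in the Rees chart**: `φ f = φ(c_jⁿ) · H` with the transform numerator
`H = e₀ⁿ + Φ^φ(e₁, …, e_d) + φ(c_j)·r` (homogeneity of `Φ`, `g ∈ 𝔭ⁿ⁺¹`). [folklore] -/
theorem cone_factor (c : Fin (d + 1) → A) (g : A) (Φ : MvPolynomial (Fin d) A)
    (hdeg : ∀ m ∈ Φ.support, Finsupp.degree m = n) (hg : g ∈ Ideal.span (Set.range c) ^ (n + 1))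
    (j : Fin (d + 1)) :
    ∃ r : chartRing c j, chartBase c j (c 0 ^ n + MvPolynomial.eval (fun i : Fin d => c i.succ) Φ + g) =
      chartBase c j (c j ^ n) * (chartGen c j 0 ^ n +
        MvPolynomial.eval₂ (chartBase c j) (fun i : Fin d => chartGen c j i.succ) Φ + chartBase c j (c j) * r) := by
  set φ : A →+* chartRing c j := chartBase c j with hφ
  have huB : ∀ l, φ (c l) = φ (c j) * chartGen c j l := fun l => reesChartBase_apply_eq_mul_chartGen c j l
  have hφg : φ g ∈ Ideal.span {φ (c j) ^ (n + 1)} := by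
    have h := Ideal.mem_map_of_mem φ hg
    rwa [Ideal.map_pow, Ideal.map_span_range_eq_span_singleton φ c j _ huB, Ideal.span_singleton_pow] at h
  obtain ⟨r, hr⟩ := Ideal.mem_span_singleton'.mp hφg
  refine ⟨r, ?_⟩
  have h1 : φ (MvPolynomial.eval (fun i : Fin d => c i.succ) Φ) =
      φ (c j) ^ n * MvPolynomial.eval₂ φ (fun i : Fin d => chartGen c j i.succ) Φ := by
    rw [← MvPolynomial.eval₂_id, MvPolynomial.eval₂_comp_left, RingHom.comp_id,
      show (φ ∘ fun i : Fin d => c i.succ) = fun i : Fin d => φ (c j) * chartGen c j i.succ from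
        funext fun i => huB i.succ]
    exact eval₂_mul_smul_of_degree_eq φ Φ hdeg _ _
  rw [map_add, map_add, map_pow, huB 0, h1, ← hr, map_pow]
  ring

/-- **Generic branch** (`e₀ ∉ 𝔴`, in particular the whole `c₀`-chart where `e₀ = 1`): the transform numerator `H` is
not in the prime `𝔴` over `𝔪_A` — `Φ^φ(e) ∈ 𝔴` (coefficients in `𝔪_A`) and `φ(c_j)·r ∈ 𝔴`, so `H ∈ 𝔴` would force
`e₀ⁿ ∈ 𝔴`. [folklore] -/
theorem cone_num_not_mem [IsLocalRing A] (c : Fin (d + 1) → A) (Φ : MvPolynomial (Fin d) A)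
    (hcoef : ∀ m ∈ Φ.support, Φ.coeff m ∈ maximalIdeal A) (hcA : ∀ l, c l ∈ maximalIdeal A)
    (j : Fin (d + 1)) (𝔴 : Ideal (chartRing c j)) [𝔴.IsPrime] (h𝔴 : 𝔴.comap (chartBase c j) = maximalIdeal A)
    (h0 : chartGen c j 0 ∉ 𝔴) (r : chartRing c j) :
    chartGen c j 0 ^ n + MvPolynomial.eval₂ (chartBase c j) (fun i : Fin d => chartGen c j i.succ) Φ +
      chartBase c j (c j) * r ∉ 𝔴 := by
  have hmemA : ∀ x : A, chartBase c j x ∈ 𝔴 ↔ x ∈ maximalIdeal A := fun x => by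
    rw [← Ideal.mem_comap, h𝔴]
  have hE : MvPolynomial.eval₂ (chartBase c j) (fun i : Fin d => chartGen c j i.succ) Φ ∈ 𝔴 :=
    eval₂_mem_of_coeff_mem _ Φ 𝔴 (fun m hm => (hmemA _).mpr (hcoef m hm)) _
  have ht : chartBase c j (c j) * r ∈ 𝔴 := 𝔴.mul_mem_right _ ((hmemA _).mpr (hcA j))
  intro hH
  have h := 𝔴.sub_mem hH (𝔴.add_mem hE ht)
  have hre : chartGen c j 0 ^ n + MvPolynomial.eval₂ (chartBase c j) (fun i : Fin d => chartGen c j i.succ) Φ +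
      chartBase c j (c j) * r - (MvPolynomial.eval₂ (chartBase c j) (fun i : Fin d => chartGen c j i.succ) Φ +
        chartBase c j (c j) * r) = chartGen c j 0 ^ n := by ring
  rw [hre] at h
  exact h0 (‹𝔴.IsPrime›.mem_of_pow_mem n h)

/-- **Polar branch** (`e₀ ∈ 𝔴`, chart `j = j'.succ`): `s·H ∈ 𝔴ⁿ` with `s ∉ 𝔴` is impossible for a cone-shallow frame.
Push along the quotient dictionary `q : B ↠ (A/𝔭)[T_i : i ≠ j]`: `q H = T₀ⁿ + Ψ`, `q(𝔴)` is a prime containing `v̄`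
and `T₀` but not `q s`; in the REGULAR ring `(A/𝔭)[T]` Zariski–Nagata (`mem_pow_of_mul_mem_pow_of_le`) gives
`T₀ⁿ + Ψ ∈ 𝔑'ⁿ` for a maximal `𝔑' ⊇ q(𝔴)`, so `Ψ ∈ 𝔑'ⁿ` — against `ConeShallow` (`coneShallow_rename`).
[cite: CossartJannsenSaito2020, Ch. 2] -/
theorem cone_polar_absurd [IsRegularLocalRing A] (c : Fin (d + 1) → A) (v : A) (Φ : MvPolynomial (Fin d) A)
    (hW : Ideal.span (Set.range (Fin.append c ![v])) = maximalIdeal A)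
    (hd : (maximalIdeal A).spanFinrank = (d + 1) + 1)
    (hcs : ConeShallow (Ideal.span (Set.range c)) v Φ n)
    (j' : Fin d) (𝔴 : Ideal (chartRing c j'.succ)) [𝔴.IsPrime]
    (h𝔴 : 𝔴.comap (chartBase c j'.succ) = maximalIdeal A) (h0 : chartGen c j'.succ 0 ∈ 𝔴)
    (r s : chartRing c j'.succ) (hs : s ∉ 𝔴)
    (hsH : s * (chartGen c j'.succ 0 ^ n +
      MvPolynomial.eval₂ (chartBase c j'.succ) (fun i : Fin d => chartGen c j'.succ i.succ) Φ +
        chartBase c j'.succ (c j'.succ) * r) ∈ 𝔴 ^ n) : False := by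
  classical
  have hmemA : ∀ x : A, chartBase c j'.succ x ∈ 𝔴 ↔ x ∈ maximalIdeal A := fun x => by
    rw [← Ideal.mem_comap, h𝔴]
  have hcA : ∀ l, c l ∈ maximalIdeal A := fun l => by
    rw [← hW]; exact Ideal.subset_span ⟨Fin.castAdd 1 l, by rw [Fin.append_left]⟩
  have hvA : v ∈ maximalIdeal A := by
    rw [← hW]; exact Ideal.subset_span ⟨Fin.natAdd (d + 1) 0, by rw [Fin.append_right]; rfl⟩
  -- the quotient dictionary
  have hqr : IsQuasiRegular c := isQuasiRegular_centre c ![v] hW hd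
  set P : Ideal A := Ideal.span (Set.range c) with hP
  set q := chartQuot c j'.succ hqr with hqdef
  have hcj : chartBase c j'.succ (c j'.succ) ∈ 𝔴 := (hmemA _).mpr (hcA _)
  obtain ⟨h𝔔, h𝔔s⟩ := map_chartQuot_isPrime c j'.succ hqr (𝔴 := 𝔴) hcj
  set 𝔔 : Ideal (MvPolynomial {i : Fin (d + 1) // i ≠ j'.succ} (A ⧸ P)) := 𝔴.map q with h𝔔def
  haveI := h𝔔
  -- `q H = T₀ⁿ + Ψ`
  have h0j : (0 : Fin (d + 1)) ≠ j'.succ := fun h => Fin.succ_ne_zero j' h.symm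
  have hfun : (q ∘ fun i : Fin d => chartGen c j'.succ i.succ) = coneSubst (A ⧸ P) j' := by
    funext i
    unfold coneSubst
    by_cases hi : i.succ = j'.succ
    · have h1 : chartGen c j'.succ j'.succ = 1 := chartGen_self c j'.succ
      rw [dif_pos hi, Function.comp_apply, hi, h1, map_one]
    · rw [dif_neg hi, Function.comp_apply]
      exact chartQuot_gen c j'.succ hqr hi
  have hcomp : q.comp (chartBase c j'.succ) = MvPolynomial.C.comp (Ideal.Quotient.mk P) :=
    RingHom.ext fun x => chartQuot_base c j'.succ hqr x
  have hqE : q (MvPolynomial.eval₂ (chartBase c j'.succ) (fun i : Fin d => chartGen c j'.succ i.succ) Φ) =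
      MvPolynomial.aeval (coneSubst (A ⧸ P) j') (MvPolynomial.map (Ideal.Quotient.mk P) Φ) := by
    rw [MvPolynomial.eval₂_comp_left, hfun, hcomp, MvPolynomial.aeval_def, MvPolynomial.algebraMap_eq,
      ← MvPolynomial.eval₂_map]
  have hq0 : q (chartGen c j'.succ 0) = MvPolynomial.X ⟨0, h0j⟩ := chartQuot_gen c j'.succ hqr h0j
  have hqH : q (chartGen c j'.succ 0 ^ n +
      MvPolynomial.eval₂ (chartBase c j'.succ) (fun i : Fin d => chartGen c j'.succ i.succ) Φ +
        chartBase c j'.succ (c j'.succ) * r) = MvPolynomial.X ⟨0, h0j⟩ ^ n +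
        MvPolynomial.aeval (coneSubst (A ⧸ P) j') (MvPolynomial.map (Ideal.Quotient.mk P) Φ) := by
    rw [q.map_add, q.map_add, q.map_mul, q.map_pow, hq0, hqE, hqdef, chartQuot_centre, zero_mul, add_zero]
  -- membership data in `(A/𝔭)[T]`
  have hqs : q s ∉ 𝔔 := fun h => hs (h𝔔s s h)
  have hqsH : q s * q (chartGen c j'.succ 0 ^ n +
      MvPolynomial.eval₂ (chartBase c j'.succ) (fun i : Fin d => chartGen c j'.succ i.succ) Φ +
        chartBase c j'.succ (c j'.succ) * r) ∈ 𝔔 ^ n := by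
    rw [← q.map_mul, h𝔔def, ← Ideal.map_pow]
    exact Ideal.mem_map_of_mem _ hsH
  rw [hqH] at hqsH
  have hv𝔔 : MvPolynomial.C (Ideal.Quotient.mk P v) ∈ 𝔔 := by
    rw [← chartQuot_base c j'.succ hqr v]
    exact Ideal.mem_map_of_mem _ ((hmemA v).mpr hvA)
  have h0𝔔 : (MvPolynomial.X ⟨0, h0j⟩ : MvPolynomial {i : Fin (d + 1) // i ≠ j'.succ} (A ⧸ P)) ∈ 𝔔 := by
    rw [← hq0]
    exact Ideal.mem_map_of_mem _ h0
  -- the regular ring `(A/𝔭)[T]` and a maximal ideal over `𝔔`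
  haveI : IsRegularLocalRing (A ⧸ P) := isRegularLocalRing_quot_centre c ![v] hW hd
  haveI : IsRegularRing (A ⧸ P) := isRegularRing_of_isRegularLocalRing (A ⧸ P)
  obtain ⟨𝔑', h𝔑', hle'⟩ := Ideal.exists_le_maximal 𝔔 h𝔔.ne_top
  haveI := h𝔑'
  have hmem' := mem_pow_of_mul_mem_pow_of_le hle' hqs hqsH
  have hΨ : MvPolynomial.aeval (coneSubst (A ⧸ P) j') (MvPolynomial.map (Ideal.Quotient.mk P) Φ) ∈ 𝔑' ^ n := by
    have h := (𝔑' ^ n).sub_mem hmem' (Ideal.pow_mem_pow (hle' h0𝔔) n)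
    rwa [add_sub_cancel_left] at h
  exact coneShallow_rename P v Φ hcs j' 𝔑' (hle' hv𝔔) (hle' h0𝔔) hΨ

/-- **THE CHART LAW.**  At a point of `Bl_𝔭 Spec A` over the closed point (a prime `𝔴` of the chart `B = chartRing c j`
over `𝔪_A`, local ring `S = B_𝔴`), for a cone-shallow frame the controlled transform `(𝓘𝒪_S : tⁿ)`, `t = σ(c_j)`, is
NOT inside `𝔪_Sⁿ`: `σ f = tⁿ·χ(H)` puts `χ H` in the colon ideal; if `e₀ ∉ 𝔴` it is a unit (`cone_num_not_mem`), and
if `e₀ ∈ 𝔴` then `χ H ∈ 𝔪_Sⁿ` descends to `s·H ∈ 𝔴ⁿ`, `s ∉ 𝔴`, excluded by `cone_polar_absurd`.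
[cite: CossartJannsenSaito2020, Ch. 2; CossartPiltant2008, Prop. 4.2] -/
theorem cone_chart [IsRegularLocalRing A] {J : Ideal A} (hn : 1 ≤ n) (c : Fin (d + 1) → A) (v g : A)
    (Φ : MvPolynomial (Fin d) A)
    (hW : Ideal.span (Set.range (Fin.append c ![v])) = maximalIdeal A)
    (hd : (maximalIdeal A).spanFinrank = (d + 1) + 1)
    (hdeg : ∀ m ∈ Φ.support, Finsupp.degree m = n)
    (hcoef : ∀ m ∈ Φ.support, Φ.coeff m ∈ maximalIdeal A)
    (hg : g ∈ Ideal.span (Set.range c) ^ (n + 1))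
    (hf : c 0 ^ n + MvPolynomial.eval (fun i : Fin d => c i.succ) Φ + g ∈ J)
    (hcs : ConeShallow (Ideal.span (Set.range c)) v Φ n)
    (j : Fin (d + 1)) (𝔴 : PrimeSpectrum (chartRing c j)) {S : Type} [CommRing S] [IsLocalRing S]
    (χ : chartRing c j →+* S) (hlocχ : @IsLocalization.AtPrime _ _ S _ χ.toAlgebra 𝔴.asIdeal _)
    (h𝔴 : 𝔴.asIdeal.comap (chartBase c j) = maximalIdeal A)
    (σ : A →+* S) (hσ : ∀ x, χ (chartBase c j x) = σ x) :
    ¬ Submodule.colon (J.map σ) ((Ideal.span {σ (c j)} ^ n : Ideal S) : Set S) ≤ maximalIdeal S ^ n := by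
  letI := χ.toAlgebra
  haveI : IsLocalization.AtPrime S 𝔴.asIdeal := hlocχ
  have halg : ∀ b, algebraMap (chartRing c j) S b = χ b := fun b =>
    RingHom.congr_fun (RingHom.algebraMap_toAlgebra χ) b
  have hcA : ∀ l, c l ∈ maximalIdeal A := fun l => by
    rw [← hW]; exact Ideal.subset_span ⟨Fin.castAdd 1 l, by rw [Fin.append_left]⟩
  obtain ⟨r, hr⟩ := cone_factor c g Φ hdeg hg j
  set H : chartRing c j := chartGen c j 0 ^ n +
    MvPolynomial.eval₂ (chartBase c j) (fun i : Fin d => chartGen c j i.succ) Φ + chartBase c j (c j) * r with hH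
  have hσf : σ (c 0 ^ n + MvPolynomial.eval (fun i : Fin d => c i.succ) Φ + g) = σ (c j) ^ n * χ H := by
    rw [← hσ, hr, χ.map_mul, hσ, map_pow]
  have hmem := TowerCut.mem_colon_of_map_eq σ hf hσf
  intro hle
  have hHn : χ H ∈ maximalIdeal S ^ n := hle hmem
  by_cases h0 : chartGen c j 0 ∈ 𝔴.asIdeal
  · -- polar branch: `j = j'.succ`, descend and contradict `ConeShallow`
    obtain ⟨s, hs, hsH⟩ :=
      OrderSemicontinuity.exists_mul_mem_pow_of_algebraMap_mem_maximalIdeal_pow_general 𝔴.asIdeal S (x := H)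
        (by rw [halg]; exact hHn)
    have hj : j ≠ 0 := by
      rintro rfl
      have h1 : chartGen c 0 0 = 1 := chartGen_self c 0
      rw [h1] at h0
      exact 𝔴.isPrime.ne_top ((Ideal.eq_top_iff_one _).mpr h0)
    obtain ⟨j', rfl⟩ := Fin.exists_succ_eq.mpr hj
    exact cone_polar_absurd c v Φ hW hd hcs j' 𝔴.asIdeal h𝔴 h0 r s hs hsH
  · -- generic branch: `χ H` is a unit, so `𝔪_Sⁿ = (1)`, absurd for `n ≥ 1`
    have hHu : IsUnit (χ H) := by
      rw [← halg]
      exact IsLocalization.map_units S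
        (⟨H, cone_num_not_mem c Φ hcoef hcA j 𝔴.asIdeal h𝔴 h0 r⟩ : 𝔴.asIdeal.primeCompl)
    have htop : maximalIdeal S ^ n = ⊤ := Ideal.eq_top_of_isUnit_mem _ hHn hHu
    have h := Ideal.pow_le_self (I := maximalIdeal S) (n := n) (by omega)
    rw [htop, top_le_iff] at h
    exact (maximalIdeal.isMaximal S).ne_top h

end Chart

end Summit.ResolutionOfSingularities.ResolutionOfSingularities.Theorems.ShallowCut
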